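import Summits.Ventures.YMGap.YM3IR.BalabanCeilings
import Summits.Ventures.YMGap.RobustBall.StarRowsSU3PVW
import HarnessLib

/-!
# YM3IR / BalabanCeilingsSU3PVW — the §Y4 sentence for `SU(3)` on the TIER-2 (weighted, infinite-range) ball at engine-2's
HYPOTHESIS-FREE PV-star W rows (Wilson `β_W = 2/5`, working row `β_W = 1/3`), with the counted crossover (theorems only; no new
conjecture name)

HONEST FRAMING (cell pub-ymgap, track Y4 / YM3-IR, seat ym3ir-theory-1, gen 11; follow-up to `YM3IR/BalabanCeilings.lean` (every-`N`
tier-2 sentences `massGap3Cofinal_suN_W_free_of_irConjecture3(Cov)`, hypothesis-free, tree ceiling `N/64`, i.e. Wilson `9/64` at `N = 3`),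
`YM3IR/BalabanCeilingsSU3CertifiedW.lean` (tier-2 certified-star W row GIVEN H1/H2, Wilson `3/4`) and `YM3IR/BalabanCeilingsSU3PV.lean`
(tier-1 hypothesis-free PV-star rows, Wilson `12/25`), written once engine-2 (g9)'s `RobustBall/StarRowsSU3PVW.lean` — ds-2's WEIGHTED
robust vertex-star door `RobustStarDoorW` (Dobrushin–Shlosman window iteration with Georgii's exponential weights, NO finite-range
hypothesis) run on engine-2's HYPOTHESIS-FREE Poincaré × Schwinger–Dyson one-link modulus `OneLinkVarianceSD.su3_oneLinkKRModulus_pv_of_le`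
— was in the tree (R212 (iii)).  This file claims NO summit, NO mass gap and NO part of Bałaban's theorems.  It is kernel-checked
BOOKKEEPING: `BalabanSUN.massGap3Cofinal_suN_balaban_of_irConjecture3` at `N = 3` with track Y2's input (`ClusterDomainClustering` on the
TIER-2 ball `ClusterDomain κ_b (23/500) (23/1000)`, every ball parameter `κ_b ≥ log (6/5)`, rate `log (6/5)`) DISCHARGED BY NAME by
engine-2's hypothesis-free cell `RobustBall.su3_clusterDomainClusteringW_dim3_pvStar_twoFifths hκb` (tree ceiling `2/15` = Wilson
`β_W = 2/5` — the highest HYPOTHESIS-FREE `SU(3)` tier-2 `d = 3` ceiling in the tree; radius a door artefact) and by the working row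
`RobustBall.su3_clusterDomainClusteringW_dim3_pvStar_oneThird hκb` (tree ceiling `1/9` = Wilson `1/3`, larger ball
`ClusterDomain κ_b (1/10) (1/20)`).  WHAT MOVES on the UV side: the HYPOTHESIS-FREE `SU(3)` receiving end of the §Y4 sentence ON THE BALL IN
WHICH THE CONJECTURE OF RECORD IS TYPED (the weighted `ClusterDomain κ ε₀ ε₁` of `YM3IR/Statement.lean`) rises from Wilson `9/64`
(`BalabanCeilings`, every-`N` sentence at `N = 3`) to `2/5`; the CERTIFIED tier-2 row GIVEN H1, H2 (`BalabanCeilingsSU3CertifiedW`, Wilson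
`3/4`) is untouched and remains higher.  Lattice statements only; strong-coupling constants; no continuum limit, no Millennium claim; no
axiom, no `sorry`, no `def`; `0` compute.

THE HYPOTHESIS LIST, VERBATIM (`massGap3Cofinal_su3_W_pvStar_twoFifths_of_irConjecture3`): `BalabanUV3 mk` — IN PRINT (Bałaban, CMP 102
(1985), Thm 1 p. 257 + Thm 2 p. 272), logically IDLE in the arrow (theory-2 F2; R196); `Nonempty (Family L eps0)` — print's clauses at one
coupling (p. 256 L15–18); `0 < C_b`, `0 < κ`; `log (6/5) ≤ κ_b` (the ball parameter);
`IRConjecture3 (ballOfRobustBall 3 κ_b (23/500) (23/1000) (2/15)) suFrobDist (fundamentalRep (Fin 3)) (balabanCouplings L (suGroupModel 3)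
eps0) C_b κ` — the CONJECTURE of record (theory-2, `YM3IR/Statement.lean`; NOT in print).  LABEL OF RECORD (R196, verbatim): a typed
INTERFACE / dictionary, NOT a reduction — with existential `(C_b, κ)` the free-family conjecture is target-equivalent on every receiving
ball in the tree (theory-2, `YM3IR/ForestWitness.lean`, `YM3IR/ForestWitnessSUN.lean`: the forest witness enters any ball containing product
Haar, the tier-2 balls included, `ForestWitnessSUN.forestWitness3_ball`); the covariant form `IRConjecture3Cov` (`YM3IR/CovariantFamily.lean`)
is a genuine sufficient condition, possibly strictly stronger, converse NOT known — never "the remaining gap".  CONCLUSION: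
`MassGap3Cofinal (balabanCouplings L (suGroupModel 3) eps0) suFrobDist (fundamentalRep (Fin 3))`.

COUNTED CROSSOVER (PROVED arithmetic, tree units `β = β_W/3`): below the ceiling `2/15` after `K + M'` steps iff `L^{M'} ≥ 5/(2γ₀²)`
(`su3_betaTree_div_pow_le_2_15_iff`); since `γ₀² ≤ 1` this forces `5/2 ≤ L^{M'}`, in particular `M' ≥ 1`
(`su3_row_W_pvStar_twoFifths_crossover_steps` / `_pos`) — vs `4/(3γ₀²)` at the certified tier-2 `1/4` (`BalabanCeilingsSU3CertifiedW`) and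
`25/(12γ₀²)` at the hypothesis-free tier-1 `4/25` (`BalabanCeilingsSU3PV`).

WHY THIS IS USEFUL (one sentence).  It records, by name and kernel-checked, the §Y4 sentence for the physical colour group on the weighted
ball of `YM3IR/Statement.lean` with Y2's input a HYPOTHESIS-FREE theorem up to Wilson `β_W = 2/5` — the hypothesis-free companion of the
certified `3/4` row — and what that leaves for the crossover (`L^{M'} ≥ 5/(2γ₀²)`).

References: T. Bałaban, CMP 102 (1985) 255–275, p. 256 L15–18, (5) p. 256, Thm 1 p. 257, Thm 2 p. 272 [cite: Balaban1985UV3]; CMP 98 (1985)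
17–51, (11), (15) p. 19 [cite: Balaban1985Averaging] (block locality = a property of the average (15), no numbered display); H. Shen, R. Zhu,
X. Zhu, CMP 400 (2023) (the vertex σ-model dictionary behind the star rows; engine-2's file header).
-/

noncomputable section

open MeasureTheory
open Literature.MathematicalPhysics.QuantumLattice Literature.MathematicalPhysics.QuantumFieldTheory
open Balaban1985CMP102 Balaban1985CMP102.Setting Balaban1985CMP102.Theorems
open Literature.MathematicalPhysics.QuantumFieldTheory.Balaban1983to89 (GaugeGroup HaarData)
open Summit.QuantumFields.Balaban3D.Carriers (suGroupModel)

namespace Summit.Ventures.YMGap.YM3IR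

open CarrierBridge

/-! ## §1  Wilson `β_W = 2/5` on the weighted ball `ClusterDomain κ_b (23/500) (23/1000)`, rate `log (6/5)`, every `κ_b ≥ log (6/5)` -/

/-- **`SU(3)` lattice YM₃ mass gap on Bałaban's coupling set, receiving on the TIER-2 ball at Wilson `β_W = 2/5`, Y2's input
HYPOTHESIS-FREE (PROVED bookkeeping).**  engine-2's weighted PV-star cell `RobustBall.su3_clusterDomainClusteringW_dim3_pvStar_twoFifths hκb`
BY NAME (tree ceiling `2/15`, ball `ClusterDomain κ_b (23/500) (23/1000)` for every `κ_b ≥ log (6/5)`, rate `log (6/5)`).  The hypothesis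
that is neither in print nor certified is `IRConjecture3` (label of record R196: a dictionary, not a reduction; `BalabanUV3 mk` is logically
idle). [cite: Balaban1985UV3, Thm 1 p.257; Thm 2 p.272] -/
theorem massGap3Cofinal_su3_W_pvStar_twoFifths_of_irConjecture3 {L : ℕ} {mk : Construction L} {eps0 : ℝ → ℝ}
    (hfam : Nonempty (Family L eps0)) {κ_b C_b κ : ℝ} (hκb : Real.log (6 / 5) ≤ κ_b) (hC : 0 < C_b) (hκ : 0 < κ)
    (hUV : BalabanUV3 mk)
    (hIR : IRConjecture3 (ballOfRobustBall 3 κ_b (23 / 500) (23 / 1000) (2 / 15)) suFrobDist (fundamentalRep (Fin 3))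
      (balabanCouplings L (suGroupModel 3) eps0) C_b κ) :
    MassGap3Cofinal (balabanCouplings L (suGroupModel 3) eps0) suFrobDist
      (fundamentalRep (Fin 3) : RobustBall.SUN 3 →* Matrix (Fin 3) (Fin 3) ℂ) :=
  massGap3Cofinal_suN_balaban_of_irConjecture3 hfam hC hκ RobustBall.log_sixFifths_pos_and_log_threeHalves_pos.1 hUV
    (RobustBall.su3_clusterDomainClusteringW_dim3_pvStar_twoFifths hκb).1 hIR

/-- **The COVARIANT §Y4 sentence on the tier-2 ball at Wilson `β_W = 2/5`, Y2's input HYPOTHESIS-FREE (PROVED bookkeeping; the shape of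
`CovariantFamily.massGap3Cofinal_su2_W_of_irConjecture3Cov` / `BalabanCeilings.massGap3Cofinal_suN_W_free_of_irConjecture3Cov`, for `SU(3)`,
ceiling `9/64 ↦ 2/5`).**  LABEL OF RECORD for `IRConjecture3Cov` (R196, verbatim): «⟹ target PROVED; converse NOT KNOWN; a genuine
sufficient condition, possibly strictly stronger, never "the remaining gap"». [cite: Balaban1985Averaging, (11), (15) p.19] -/
theorem massGap3Cofinal_su3_W_pvStar_twoFifths_of_irConjecture3Cov {L : ℕ} {mk : Construction L} {eps0 : ℝ → ℝ}
    (hfam : Nonempty (Family L eps0)) {κ_b C_b κ : ℝ} (hκb : Real.log (6 / 5) ≤ κ_b) (hC : 0 < C_b) (hκ : 0 < κ)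
    (hUV : BalabanUV3 mk)
    (hIR : IRConjecture3Cov (ballOfRobustBall 3 κ_b (23 / 500) (23 / 1000) (2 / 15)) suFrobDist (fundamentalRep (Fin 3))
      (balabanCouplings L (suGroupModel 3) eps0) C_b κ) :
    MassGap3Cofinal (balabanCouplings L (suGroupModel 3) eps0) suFrobDist
      (fundamentalRep (Fin 3) : RobustBall.SUN 3 →* Matrix (Fin 3) (Fin 3) ℂ) :=
  massGap3Cofinal_su3_W_pvStar_twoFifths_of_irConjecture3 hfam hκb hC hκ hUV (irConjecture3_of_cov hIR)

/-- **The same, PRINT-FREE (theory-2's F2 shape: `BalabanUV3 mk` and `mk` deleted; PROVED bookkeeping).**  What remains of print is the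
index set `balabanCouplings` and its unboundedness — the kernel record that `BalabanUV3` is evidential in these sentences.
[cite: Balaban1985UV3, p.256 L15–18] -/
theorem massGap3Cofinal_su3_W_pvStar_twoFifths_of_irConjecture3Cov_printFree {L : ℕ} {eps0 : ℝ → ℝ}
    (hfam : Nonempty (Family L eps0)) {κ_b C_b κ : ℝ} (hκb : Real.log (6 / 5) ≤ κ_b) (hC : 0 < C_b) (hκ : 0 < κ)
    (hIR : IRConjecture3Cov (ballOfRobustBall 3 κ_b (23 / 500) (23 / 1000) (2 / 15)) suFrobDist (fundamentalRep (Fin 3))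
      (balabanCouplings L (suGroupModel 3) eps0) C_b κ) :
    MassGap3Cofinal (balabanCouplings L (suGroupModel 3) eps0) suFrobDist
      (fundamentalRep (Fin 3) : RobustBall.SUN 3 →* Matrix (Fin 3) (Fin 3) ℂ) :=
  massGap3Cofinal_of_irConjecture3_printFree (not_bddAbove_balabanCouplings (suGroupModel 3) hfam) hC hκ
    RobustBall.log_sixFifths_pos_and_log_threeHalves_pos.1 (suFrobDist_bddAbove 3)
    (RobustBall.su3_clusterDomainClusteringW_dim3_pvStar_twoFifths hκb).1 (irConjecture3_of_cov hIR)

/-- **In PRINT'S quantifier order on the tier-2 ball at `β_W = 2/5` (PROVED bookkeeping):** `∃ eps0` first (print, p. 256 L15–18), then for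
every ball parameter `κ_b ≥ log (6/5)` and every `C_b`, `κ`: `Nonempty (Family L eps0) → IRConjecture3` on the cell's ball (label of record
R196: a dictionary, not a reduction) `⟹ MassGap3Cofinal`. [cite: Balaban1985UV3, p.256 L15–18; Thm 2 p.272] -/
theorem massGap3Cofinal_su3_W_pvStar_twoFifths_printedOrder_of_irConjecture3 {L : ℕ} (mk : Construction L)
    (hUV : BalabanUV3 mk) :
    ∃ eps0 : ℝ → ℝ, (∀ g : ℝ, 0 < g → 0 < eps0 g) ∧
      (∀ S : Family L eps0, ∀ k, k ≤ S.1.K → (mk (RobustBall.SUN 3) (suGroupModel 3) S.1).ineq41_47 k) ∧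
      ∀ (κ_b C_b κ : ℝ), Real.log (6 / 5) ≤ κ_b → 0 < C_b → 0 < κ → Nonempty (Family L eps0) →
        IRConjecture3 (ballOfRobustBall 3 κ_b (23 / 500) (23 / 1000) (2 / 15)) suFrobDist (fundamentalRep (Fin 3))
          (balabanCouplings L (suGroupModel 3) eps0) C_b κ →
          MassGap3Cofinal (balabanCouplings L (suGroupModel 3) eps0) suFrobDist
            (fundamentalRep (Fin 3) : RobustBall.SUN 3 →* Matrix (Fin 3) (Fin 3) ℂ) := by
  obtain ⟨eps0, hpos, h2, h⟩ := massGap3Cofinal_suN_balaban_printedOrder_of_irConjecture3 (N := 3) mk hUV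
  refine ⟨eps0, hpos, h2, fun κ_b C_b κ hκb hC hκ hfam hIR => ?_⟩
  exact h (ballOfRobustBall 3 κ_b (23 / 500) (23 / 1000) (2 / 15)) C_b κ (Real.log (6 / 5)) hC hκ
    RobustBall.log_sixFifths_pos_and_log_threeHalves_pos.1 hfam
    (RobustBall.su3_clusterDomainClusteringW_dim3_pvStar_twoFifths hκb).1 hIR

/-- **`SU(3)` at the hypothesis-free weighted PV-star ceiling `β⋆ = 2/15` (`β_W = 2/5`; PROVED arithmetic):** a member's coupling after
`K + M'` steps is below `2/15` iff `L^{M'} ≥ 5/(2·γ₀²)`. [cite: Balaban1985UV3, (5) p.256] -/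
theorem su3_betaTree_div_pow_le_2_15_iff {L : ℕ} (S : Scales L) (M' : ℕ) :
    betaTree (suGroupModel 3) S / (L : ℝ) ^ (S.K + M') ≤ 2 / 15 ↔ 5 / (2 * Dictionary.gammaSq S) ≤ (L : ℝ) ^ M' := by
  rw [suN_betaTree_div_pow_le_iff S M' (by norm_num : (0 : ℝ) < 2 / 15)]
  have e : (((3 : ℕ) : ℝ) * Dictionary.gammaSq S * (2 / 15))⁻¹ = 5 / (2 * Dictionary.gammaSq S) := by
    have e1 : ((3 : ℕ) : ℝ) * Dictionary.gammaSq S * (2 / 15) = 2 * Dictionary.gammaSq S / 5 := by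
      push_cast
      ring
    rw [e1, inv_div]
  rw [e]

/-- Hence at `β⋆ = 2/15` for `SU(3)` (PROVED arithmetic; `γ₀² ≤ 1`): in the window after `K + M'` steps forces `5/2 ≤ L^{M'}`.
[cite: Balaban1985UV3, (5) p.256] -/
theorem su3_fiveHalves_le_pow_of_betaTree_div_pow_le_2_15 {L : ℕ} (S : Scales L) (M' : ℕ)
    (h : betaTree (suGroupModel 3) S / (L : ℝ) ^ (S.K + M') ≤ 2 / 15) : (5 / 2 : ℝ) ≤ (L : ℝ) ^ M' := by
  have hγ : 0 < Dictionary.gammaSq S := Dictionary.gammaSq_pos S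
  have hγ1 : Dictionary.gammaSq S ≤ 1 := Dictionary.gammaSq_le_one S
  have h1 : 5 / (2 * Dictionary.gammaSq S) ≤ (L : ℝ) ^ M' := (su3_betaTree_div_pow_le_2_15_iff S M').1 h
  have h2 : (5 / 2 : ℝ) ≤ 5 / (2 * Dictionary.gammaSq S) := by
    rw [le_div_iff₀ (by positivity)]
    nlinarith
  exact h2.trans h1

/-- **The conjecture's counted task on the `SU(3)` tier-2 `β_W = 2/5` row (PROVED arithmetic), at the cell's ball for the record (ball
parameter `κ_b = log (6/5)`): `5/2 ≤ L^{M'}`.** [cite: Balaban1985UV3, (5) p.256] -/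
theorem su3_row_W_pvStar_twoFifths_crossover_steps {L : ℕ} (S : Scales L) (M' : ℕ)
    (h : betaTree (suGroupModel 3) S / (L : ℝ) ^ (S.K + M') ≤
      (ballOfRobustBall 3 (Real.log (6 / 5)) (23 / 500) (23 / 1000) (2 / 15)).βstar) :
    (5 / 2 : ℝ) ≤ (L : ℝ) ^ M' :=
  su3_fiveHalves_le_pow_of_betaTree_div_pow_le_2_15 S M' h

/-- **Hence still at least ONE block-RG step beyond Bałaban's `K` at `O(1)` effective coupling (`M' ≠ 0`) on the hypothesis-free tier-2
`SU(3)` row, for every admissible `γ₀` (PROVED arithmetic).** [cite: Balaban1985UV3, (5) p.256] -/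
theorem su3_row_W_pvStar_twoFifths_crossover_pos {L : ℕ} (S : Scales L) (M' : ℕ)
    (h : betaTree (suGroupModel 3) S / (L : ℝ) ^ (S.K + M') ≤
      (ballOfRobustBall 3 (Real.log (6 / 5)) (23 / 500) (23 / 1000) (2 / 15)).βstar) :
    M' ≠ 0 := by
  have h52 : (5 / 2 : ℝ) ≤ (L : ℝ) ^ M' := su3_row_W_pvStar_twoFifths_crossover_steps S M' h
  rintro rfl
  norm_num at h52

/-! ## §2  Working row: Wilson `β_W = 1/3` on the larger weighted ball `ClusterDomain κ_b (1/10) (1/20)`, rate `log (6/5)` -/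

/-- **The COVARIANT §Y4 sentence on the tier-2 ball `ClusterDomain κ_b (1/10) (1/20)` at Wilson `β_W = 1/3` (tree `1/9`), rate
`log (6/5)`, Y2's input HYPOTHESIS-FREE (PROVED bookkeeping):** engine-2's working cell
`RobustBall.su3_clusterDomainClusteringW_dim3_pvStar_oneThird hκb` BY NAME — a visibly larger ball than the ceiling row's `(23/500, 23/1000)`.
LABEL OF RECORD for `IRConjecture3Cov` (R196, verbatim) as in §1. [cite: Balaban1985Averaging, (11), (15) p.19] -/
theorem massGap3Cofinal_su3_W_pvStar_oneThird_of_irConjecture3Cov {L : ℕ} {mk : Construction L} {eps0 : ℝ → ℝ}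
    (hfam : Nonempty (Family L eps0)) {κ_b C_b κ : ℝ} (hκb : Real.log (6 / 5) ≤ κ_b) (hC : 0 < C_b) (hκ : 0 < κ)
    (hUV : BalabanUV3 mk)
    (hIR : IRConjecture3Cov (ballOfRobustBall 3 κ_b (1 / 10) (1 / 20) (1 / 9)) suFrobDist (fundamentalRep (Fin 3))
      (balabanCouplings L (suGroupModel 3) eps0) C_b κ) :
    MassGap3Cofinal (balabanCouplings L (suGroupModel 3) eps0) suFrobDist
      (fundamentalRep (Fin 3) : RobustBall.SUN 3 →* Matrix (Fin 3) (Fin 3) ℂ) :=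
  massGap3Cofinal_suN_balaban_of_irConjecture3 hfam hC hκ RobustBall.log_sixFifths_pos_and_log_threeHalves_pos.1 hUV
    (RobustBall.su3_clusterDomainClusteringW_dim3_pvStar_oneThird hκb).1 (irConjecture3_of_cov hIR)

end Summit.Ventures.YMGap.YM3IR

end
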